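import Literature.NumberTheory.Sieve.MaynardNFPushforward
import Literature.NumberTheory.Sieve.IdealSieveSumsSharp
import HarnessLib

/-!
# The Maynard–Tao sieve over `𝓞_K`: the main-term evaluation for general one-dimensional weights

Topic `Literature/NumberTheory/Sieve`. Sequel of `MaynardNFMainTerm.lean` (A. Castillo, C. Hall,
R. J. Lemke Oliver, P. Pollack, L. Thompson, *Bounded gaps between primes in number fields and
function fields*, Proc. AMS 143 (2015) = arXiv:1403.5808, proof of Proposition 2.1 via Maynard's
Lemmas 6.1–6.3): the same `k`-dimensional Riemann-sum evaluation, now for PER-COORDINATE weights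
`W_{c_i}(𝔲)/N𝔲`, `W_c(𝔲) = 1_{(𝔲,𝔴)=1} μ²(𝔲) ∏_{P∣𝔲}(1 + c_P)` with `|c_P| ≤ C₀/NP` (the weights
`1/φ`, `1/g`, `g N²/φ⁴, …` of the `S₂` main term are all of this shape, and all have the SAME density
`c_K φ(𝔴)/N𝔴` up to the relative error `D₀^{-1/4}` of `IdealSieveSumsSharp.abs_sum_sieveW_div_sub_sharp`).
Everything is PROVED:

* `normWeightC`, `sum_piFinset_G1_eq_weightedSumC`, `massUpTo_normWeightC_eq` — the norm
  pushforward of `W_c/N` and its counting function;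
* **`abs_sum_piFinset_G1_sub_integral_le_C`** — for `𝔴 ≠ 0`, `D₀ ≥ 1` with every prime of norm
  `≤ D₀` dividing `𝔴`, `R > 1`, weights `c_i` (`i < k`) with `|c_i(P)| ≤ C₀/NP`, `1 + c_i(P) ≥ 0`,
  `|∑_{𝔲 ∈ G1^k} (∏ᵢ W_{c_i}(𝔲ᵢ)/N𝔲ᵢ) (1_P g)((log N𝔲ᵢ/log R)ᵢ) − (c log R)^k ∫_{[0,1]^k} 1_P g| ≤ (c log R)^k B(M,ω,η)`,
  `c = c_K φ(𝔴)/N𝔴`, `η = 2M(ε + E/(c log R))`, `ε = e^{(1+2C₀)Z} D₀^{-1/4} N𝔴/φ(𝔴)`,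
  `E = e^{(1+2C₀)Z}(E_C(𝔴) + 4c_K)`.

## References

* Castillo–Hall–Lemke Oliver–Pollack–Thompson, arXiv:1403.5808, proof of Proposition 2.1.
  [CastilloEtAl2015]
* J. Maynard, *Small gaps between primes*, Ann. of Math. 181 (2015), Lemmas 6.1–6.3.
  [MaynardAnnals2015]
-/

noncomputable section

open Finset UniqueFactorizationMonoid NumberField MeasureTheory
open scoped NumberField Classical

namespace Literature.NumberTheory.Sieve.MaynardNF

open Literature.NumberTheory.LFunctions Literature.NumberTheory.LFunctions.NumberField
  Literature.NumberTheory.Sieve.MaynardTao Literature.NumberTheory.Sieve.IdealSieve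

variable {K : Type*} [Field K] [NumberField K]
variable {k : ℕ} {ι : Type*} [Fintype ι]

/-! ### The pushforward of `W_c/N` -/

variable (K) in
/-- `w_{N,c}(n) = ∑_{N𝔲 = n, 𝔲 squarefree, 𝔲 + 𝔴 = (1)} W_c(𝔲)/N𝔲`. [cite: CastilloEtAl2015, §2.2] -/
def normWeightC (𝔴 : Ideal (𝓞 K)) (c : Ideal (𝓞 K) → ℝ) (n : ℕ) : ℝ :=
  ∑ 𝔲 ∈ (idealsOfNorm K n).filter (fun 𝔲 => Squarefree 𝔲 ∧ 𝔲 ⊔ 𝔴 = ⊤),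
    sieveW 𝔴 c 𝔲 / ((Ideal.absNorm 𝔲 : ℕ) : ℝ)

/-- `W_c ≥ 0` when `1 + c_P ≥ 0` at every prime. [folklore] -/
theorem sieveW_nonneg {𝔴 : Ideal (𝓞 K)} {c : Ideal (𝓞 K) → ℝ} (hc1 : ∀ P : Ideal (𝓞 K), Prime P → 0 ≤ 1 + c P)
    (𝔲 : Ideal (𝓞 K)) : 0 ≤ sieveW 𝔴 c 𝔲 := by
  unfold sieveW
  split_ifs
  · exact Finset.prod_nonneg fun P hP => hc1 P (prime_of_normalized_factor P (Multiset.mem_toFinset.1 hP))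
  · exact le_rfl

/-- `w_{N,c} ≥ 0` when `1 + c_P ≥ 0` at every prime. [folklore] -/
theorem normWeightC_nonneg {𝔴 : Ideal (𝓞 K)} {c : Ideal (𝓞 K) → ℝ}
    (hc1 : ∀ P : Ideal (𝓞 K), Prime P → 0 ≤ 1 + c P) (n : ℕ) : 0 ≤ normWeightC K 𝔴 c n :=
  Finset.sum_nonneg fun 𝔲 _ => div_nonneg (sieveW_nonneg hc1 𝔲) (Nat.cast_nonneg _)

/-- **Pushing forward by the norm**, per-coordinate weights:
`∑_{𝔲 ∈ G1^k} (∏ᵢ W_{cᵢ}(𝔲ᵢ)/N𝔲ᵢ) H((log N𝔲ᵢ/log R)ᵢ) = weightedSum (i ↦ w_{N,cᵢ}) R H`.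
[cite: CastilloEtAl2015, §2.2 (proof of Proposition 2.1)] -/
theorem sum_piFinset_G1_eq_weightedSumC (𝔴 : Ideal (𝓞 K)) (c : Fin k → Ideal (𝓞 K) → ℝ) (R : ℝ)
    (H : (Fin k → ℝ) → ℝ) :
    ∑ 𝔲 ∈ Fintype.piFinset (fun _ : Fin k => G1 K 𝔴 R),
        (∏ i, sieveW 𝔴 (c i) (𝔲 i) / ((Ideal.absNorm (𝔲 i) : ℕ) : ℝ)) *
          H (fun i => Real.log (Ideal.absNorm (𝔲 i)) / Real.log R) =
      weightedSum (fun i => normWeightC K 𝔴 (c i)) R H := by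
  classical
  rw [weightedSum, ← Finset.sum_fiberwise_of_maps_to (s := Fintype.piFinset fun _ : Fin k => G1 K 𝔴 R)
    (t := maynardBox k R) (g := fun 𝔲 i => Ideal.absNorm (𝔲 i)) (fun 𝔲 hu => absNorm_mem_maynardBox hu)]
  refine Finset.sum_congr rfl fun n hn => ?_
  have hconst : ∀ 𝔲 ∈ (Fintype.piFinset fun _ : Fin k => G1 K 𝔴 R).filter
      (fun 𝔲 => (fun i => Ideal.absNorm (𝔲 i)) = n),
      (∏ i, sieveW 𝔴 (c i) (𝔲 i) / ((Ideal.absNorm (𝔲 i) : ℕ) : ℝ)) *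
          H (fun i => Real.log (Ideal.absNorm (𝔲 i)) / Real.log R) =
        (∏ i, sieveW 𝔴 (c i) (𝔲 i) / ((Ideal.absNorm (𝔲 i) : ℕ) : ℝ)) * H (logPos R n) := by
    intro 𝔲 hu
    have hN : (fun i => Ideal.absNorm (𝔲 i)) = n := (Finset.mem_filter.1 hu).2
    congr 2
    funext i
    rw [logPos, ← hN]
  rw [Finset.sum_congr rfl hconst, ← Finset.sum_mul]
  congr 1
  have hfib : (Fintype.piFinset fun _ : Fin k => G1 K 𝔴 R).filter
      (fun 𝔲 => (fun i => Ideal.absNorm (𝔲 i)) = n) =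
      Fintype.piFinset fun i => (G1 K 𝔴 R).filter (fun 𝔲 => Ideal.absNorm 𝔲 = n i) := by
    ext 𝔲
    simp only [Finset.mem_filter, Fintype.mem_piFinset, funext_iff]
    exact ⟨fun ⟨h1, h2⟩ i => ⟨h1 i, h2 i⟩, fun h => ⟨fun i => (h i).1, fun i => (h i).2⟩⟩
  rw [hfib, ← Finset.prod_univ_sum (fun i => (G1 K 𝔴 R).filter (fun 𝔲 => Ideal.absNorm 𝔲 = n i))
    (fun i 𝔲 => sieveW 𝔴 (c i) 𝔲 / ((Ideal.absNorm 𝔲 : ℕ) : ℝ))]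
  refine Finset.prod_congr rfl fun i _ => ?_
  have hni := (mem_maynardBox_iff.1 hn) i
  rw [normWeightC, filter_G1_absNorm_eq 𝔴 R hni.1 hni.2]

/-- **The counting function of `w_{N,c}`** is the one-dimensional sieve sum of `IdealSieveSumsSharp`:
`massUpTo (w_{N,c}) ⌊y⌋ = ∑_{0 < N𝔲 ≤ y} W_c(𝔲)/N𝔲` (`W_c` vanishes off the coprime squarefrees).
[cite: CastilloEtAl2015, §2.2] -/
theorem massUpTo_normWeightC_eq (𝔴 : Ideal (𝓞 K)) (c : Ideal (𝓞 K) → ℝ) (y : ℝ) :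
    massUpTo (normWeightC K 𝔴 c) ⌊y⌋₊ =
      ∑ 𝔲 ∈ idealsLE K y, sieveW 𝔴 c 𝔲 / ((Ideal.absNorm 𝔲 : ℕ) : ℝ) := by
  classical
  rw [massUpTo]
  simp only [normWeightC]
  rw [sum_Icc_sum_idealsOfNorm_filter_eq (fun 𝔲 => Squarefree 𝔲 ∧ 𝔲 ⊔ 𝔴 = ⊤)
    (fun 𝔲 => sieveW 𝔴 c 𝔲 / ((Ideal.absNorm 𝔲 : ℕ) : ℝ)) y, Finset.sum_filter]
  refine Finset.sum_congr rfl fun 𝔲 _ => ?_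
  split_ifs with h
  · rfl
  · rw [sieveW, if_neg (fun h' => h ⟨h'.2, h'.1⟩), zero_div]

/-! ### The main-term evaluation with per-coordinate weights -/

/-- **The main-term evaluation over `𝓞_K` with per-coordinate weights `W_{c_i}/N`**: with `C, Z`
the constants of `IdealSieveSumsSharp.abs_sum_sieveW_div_sub_sharp` (hypothesis `hsharp`, to be fed
with that theorem), `d = φ(𝔴)/N𝔴 = ∑_{𝔢∣𝔴} μ(𝔢)/N𝔢`, `c = c_K d`, `ε = e^{(1+2C₀)Z} D₀^{-1/4}/d`,
`E = e^{(1+2C₀)Z}(E_C(𝔴) + 4c_K)`, for every polytope `P` of simplex type and `g` continuous on the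
cube: `|∑_{𝔲 ∈ G1^k} (∏ᵢ W_{cᵢ}(𝔲ᵢ)/N𝔲ᵢ) (1_P g)((log N𝔲ᵢ/log R)ᵢ) − (c log R)^k ∫_{[0,1]^k} 1_P g|
 ≤ (c log R)^k (((1+η)^k + 1)(ω + 2 Gmax L'/M) + Gmax((1+η)^k − 1))`, `η = 2M(ε + E/(c log R))`.
[cite: CastilloEtAl2015, proof of Proposition 2.1; MaynardAnnals2015, Lemmas 6.1–6.3] -/
theorem abs_sum_piFinset_G1_sub_integral_le_C (hk : 0 < k) {C Z : ℝ} (hC0 : 0 ≤ C)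
    (hsharp : ∀ (𝔴 : Ideal (𝓞 K)), 𝔴 ≠ ⊥ → ∀ (c : Ideal (𝓞 K) → ℝ) (C₀ : ℝ),
      0 ≤ C₀ → (∀ P : Ideal (𝓞 K), Prime P → |c P| ≤ C₀ / Ideal.absNorm P) → ∀ D₀ : ℝ, 1 ≤ D₀ →
      (∀ P : Ideal (𝓞 K), Prime P → (Ideal.absNorm P : ℝ) ≤ D₀ → P ∣ 𝔴) → ∀ x : ℝ, 1 ≤ x →
      |∑ 𝔲 ∈ idealsLE K x, sieveW 𝔴 c 𝔲 / ((Ideal.absNorm 𝔲 : ℕ) : ℝ) -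
          dedekindZeta_residue K *
            (∑ 𝔢 ∈ idealDivisors K 𝔴, (idealMoebius 𝔢 : ℝ) / Ideal.absNorm 𝔢) * Real.log x| ≤
        Real.exp ((1 + 2 * C₀) * Z) *
          ((∑ 𝔢 ∈ idealDivisors K 𝔴,
              (C + dedekindZeta_residue K * Real.log (Ideal.absNorm 𝔢)) / Ideal.absNorm 𝔢) +
            4 * dedekindZeta_residue K +
            dedekindZeta_residue K * D₀ ^ (-(1 : ℝ) / 4) * Real.log x))
    {𝔴 : Ideal (𝓞 K)} (h𝔴 : 𝔴 ≠ ⊥) {D₀ : ℝ} (hD₀ : 1 ≤ D₀)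
    (hD : ∀ P : Ideal (𝓞 K), Prime P → (Ideal.absNorm P : ℝ) ≤ D₀ → P ∣ 𝔴)
    {cw : Fin k → Ideal (𝓞 K) → ℝ} {C₀ : ℝ} (hC₀ : 0 ≤ C₀)
    (hcw : ∀ i, ∀ P : Ideal (𝓞 K), Prime P → |cw i P| ≤ C₀ / Ideal.absNorm P)
    (hcw1 : ∀ i, ∀ P : Ideal (𝓞 K), Prime P → 0 ≤ 1 + cw i P)
    {R : ℝ} (hR : 1 < R) {M : ℕ} (hM : 0 < M) (S : ι → Finset (Fin k))
    {g : (Fin k → ℝ) → ℝ} {ω Gmax : ℝ} (hω : 0 ≤ ω) (hGmax : 0 ≤ Gmax)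
    (hcont : ∀ t ∈ maynardCube k, ∀ t' ∈ maynardCube k, (∀ i, |t i - t' i| ≤ 1 / (M : ℝ)) → |g t - g t'| ≤ ω)
    (hgb : ∀ t ∈ maynardCube k, |g t| ≤ Gmax)
    (hint : IntegrableOn ((polytope S).indicator g) (maynardCube k) volume)
    {d c ε E : ℝ} (hd : d = ∑ 𝔢 ∈ idealDivisors K 𝔴, (idealMoebius 𝔢 : ℝ) / Ideal.absNorm 𝔢)
    (hc : c = dedekindZeta_residue K * d)
    (hε : ε = Real.exp ((1 + 2 * C₀) * Z) * D₀ ^ (-(1 : ℝ) / 4) / d)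
    (hE : E = Real.exp ((1 + 2 * C₀) * Z) * ((∑ 𝔢 ∈ idealDivisors K 𝔴,
        (C + dedekindZeta_residue K * Real.log (Ideal.absNorm 𝔢)) / Ideal.absNorm 𝔢) +
          4 * dedekindZeta_residue K)) :
    |∑ 𝔲 ∈ Fintype.piFinset (fun _ : Fin k => G1 K 𝔴 R),
        (∏ i, sieveW 𝔴 (cw i) (𝔲 i) / ((Ideal.absNorm (𝔲 i) : ℕ) : ℝ)) *
          (polytope S).indicator g (fun i => Real.log (Ideal.absNorm (𝔲 i)) / Real.log R) -
        (c * Real.log R) ^ k * ∫ t in maynardCube k, (polytope S).indicator g t| ≤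
      (c * Real.log R) ^ k *
        (((1 + 2 * M * (ε + E / (c * Real.log R))) ^ k + 1) *
            (ω + 2 * Gmax * (∑ l, ((S l).card + 1 : ℝ)) / M) +
          Gmax * ((1 + 2 * M * (ε + E / (c * Real.log R))) ^ k - 1)) := by
  -- `d > 0`, `c > 0`
  have hd0 : 0 < d := by
    rw [hd, dsum_eq_prod_one_sub_inv h𝔴]
    refine Finset.prod_pos fun P hP => ?_
    have h2 : (2 : ℝ) ≤ Ideal.absNorm P := by
      exact_mod_cast two_le_absNorm_of_prime (prime_of_normalized_factor P (Multiset.mem_toFinset.1 hP))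
    have : 1 / (Ideal.absNorm P : ℝ) ≤ 1 / 2 := one_div_le_one_div_of_le (by norm_num) h2
    linarith
  have hρ0 : 0 < dedekindZeta_residue K := dedekindZeta_residue_pos K
  have hc0 : 0 < c := by rw [hc]; exact mul_pos hρ0 hd0
  have hε0 : 0 ≤ ε := by rw [hε]; positivity
  have hEC0 : 0 ≤ ∑ 𝔢 ∈ idealDivisors K 𝔴,
      (C + dedekindZeta_residue K * Real.log (Ideal.absNorm 𝔢)) / Ideal.absNorm 𝔢 := by
    refine Finset.sum_nonneg fun 𝔢 h𝔢 => div_nonneg (add_nonneg hC0 (mul_nonneg hρ0.le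
      (Real.log_nonneg ?_))) (Nat.cast_nonneg _)
    exact_mod_cast Nat.one_le_iff_ne_zero.2 (by
      rw [Ne, Ideal.absNorm_eq_zero_iff]; exact ne_bot_of_mem_idealDivisors h𝔴 h𝔢)
  have hE0 : 0 ≤ E := by rw [hE]; positivity
  -- the counting functions
  have hH : ∀ i, ∀ y : ℝ, 1 ≤ y → |massUpTo (normWeightC K 𝔴 (cw i)) ⌊y⌋₊ - c * Real.log y| ≤
      ε * c * Real.log y + E := by
    intro i y hy
    rw [massUpTo_normWeightC_eq, hc]
    have h := hsharp 𝔴 h𝔴 (cw i) C₀ hC₀ (hcw i) D₀ hD₀ hD y hy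
    rw [← hd] at h
    have hεc : ε * (dedekindZeta_residue K * d) =
        Real.exp ((1 + 2 * C₀) * Z) * D₀ ^ (-(1 : ℝ) / 4) * dedekindZeta_residue K := by
      rw [hε]; field_simp
    rw [hεc, hE]
    refine h.trans (le_of_eq ?_)
    ring
  rw [sum_piFinset_G1_eq_weightedSumC]
  exact abs_weightedSum_sub_integral_le hk S (wt := fun i => normWeightC K 𝔴 (cw i))
    (fun i u => normWeightC_nonneg (hcw1 i) u) hc0 hε0 hE0 hH hR hM hω hGmax hcont hgb hint

end Literature.NumberTheory.Sieve.MaynardNF
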